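import Summits.AnomalousDissipation.AnomalousDissipation.Theorems.SawtoothPulseCascadeK1LocalisedCascadeKHStablePulseResponse

/-!
# K2 lane (route-2 `SawtoothPulseCascade`, crux dir `K1LocalisedCascade`): assembling one COMPONENT of the created sheet amplitudes from the four source responses

Helper file of the K2 lane (ACL item stmt-AnomalousDissipation-19491; S2-cert forced part / P1″). The created amplitudes of the stable block are
`q(θ) = ∫₀^θ P(θ−s) f(s) ds` with `P(t) = cos(ωt)·1 + (sin(ωt)/ω)·X` and `f(s) = (c₀ S₀(s), c₁ S₁(s))` (`S₀, S₁` the single-mode sources at the kink lines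
`y = ¼, −¼`, `c₀ = −2κi`, `c₁ = 2κi`, `κ = 2πa`; p4's `sheetAmps`/`propagator`/`forcing`). Component `i` is
`∫₀^θ [cos(ω(θ−s))·c_i S_i(s) + (sin(ω(θ−s))/ω)·(X_{i0} c₀ S₀(s) + X_{i1} c₁ S₁(s))] ds`, so from bounds on the four basic responses
`‖∫ cos·S_j‖ ≤ Bc_j`, `‖∫ (sin/ω)·S_j‖ ≤ Bs_j` (the twelve-term bounds of `…KHSourceResponse`) one gets
`‖q_i(θ)‖ ≤ ‖c_i‖·Bc_i + ‖X_{i0}‖‖c₀‖·Bs₀ + ‖X_{i1}‖‖c₁‖·Bs₁` (`norm_component_le`, generic in continuous sources and constants).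
No definitions; no statement about the crux. [folklore] [problem: turb]
-/

-- `Summit.<Summit>.<Problem>`: single-conjunct summit, the duplicate namespace segment is deliberate.
set_option linter.dupNamespace false

noncomputable section

namespace Summit.AnomalousDissipation.AnomalousDissipation.Theorems.SawtoothPulseCascade.K2PhaseBudget

open Set MeasureTheory intervalIntegral

/-- **Component assembly.** For continuous sources `S₀, S₁ : ℝ → ℂ`, constants `cᵢ, c₀, c₁, x₀, x₁ ∈ ℂ`, a continuous real kernel pair
`kc, ks` (the propagator entries `cos(ω(θ−s))`, `sin(ω(θ−s))/ω`) and `Sᵢ ∈ {S₀, S₁}` (given as a function with its own cosine bound):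
`‖∫_a^b [kc·(cᵢSᵢ) + ks·(x₀(c₀S₀) + x₁(c₁S₁))]‖ ≤ ‖cᵢ‖Bcᵢ + ‖x₀‖‖c₀‖Bs₀ + ‖x₁‖‖c₁‖Bs₁`. [folklore] -/
theorem norm_component_le {kc ks : ℝ → ℝ} (hkc : Continuous kc) (hks : Continuous ks) {S₀ S₁ Si : ℝ → ℂ}
    (hS₀ : Continuous S₀) (hS₁ : Continuous S₁) (hSi : Continuous Si) (ci c₀ c₁ x₀ x₁ : ℂ) {a b Bci Bs₀ Bs₁ : ℝ}
    (hBci : ‖∫ s in a..b, (kc s : ℂ) * Si s‖ ≤ Bci) (hBs₀ : ‖∫ s in a..b, (ks s : ℂ) * S₀ s‖ ≤ Bs₀)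
    (hBs₁ : ‖∫ s in a..b, (ks s : ℂ) * S₁ s‖ ≤ Bs₁) :
    ‖∫ s in a..b, ((kc s : ℂ) * (ci * Si s) + (ks s : ℂ) * (x₀ * (c₀ * S₀ s) + x₁ * (c₁ * S₁ s)))‖ ≤
      ‖ci‖ * Bci + ‖x₀‖ * ‖c₀‖ * Bs₀ + ‖x₁‖ * ‖c₁‖ * Bs₁ := by
  have ic : IntervalIntegrable (fun s => (kc s : ℂ) * Si s) volume a b :=
    ((Complex.continuous_ofReal.comp hkc).mul hSi).intervalIntegrable _ _
  have i0 : IntervalIntegrable (fun s => (ks s : ℂ) * S₀ s) volume a b :=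
    ((Complex.continuous_ofReal.comp hks).mul hS₀).intervalIntegrable _ _
  have i1 : IntervalIntegrable (fun s => (ks s : ℂ) * S₁ s) volume a b :=
    ((Complex.continuous_ofReal.comp hks).mul hS₁).intervalIntegrable _ _
  have hpt : ∀ s : ℝ, (kc s : ℂ) * (ci * Si s) + (ks s : ℂ) * (x₀ * (c₀ * S₀ s) + x₁ * (c₁ * S₁ s)) =
      ci * ((kc s : ℂ) * Si s) + (x₀ * c₀) * ((ks s : ℂ) * S₀ s) + (x₁ * c₁) * ((ks s : ℂ) * S₁ s) := by
    intro s; ring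
  simp_rw [hpt]
  rw [intervalIntegral.integral_add ((ic.const_mul _).add (i0.const_mul _)) (i1.const_mul _),
    intervalIntegral.integral_add (ic.const_mul _) (i0.const_mul _), intervalIntegral.integral_const_mul,
    intervalIntegral.integral_const_mul, intervalIntegral.integral_const_mul]
  calc _ ≤ ‖ci * ∫ s in a..b, (kc s : ℂ) * Si s‖ + ‖x₀ * c₀ * ∫ s in a..b, (ks s : ℂ) * S₀ s‖ +
        ‖x₁ * c₁ * ∫ s in a..b, (ks s : ℂ) * S₁ s‖ := norm_add₃_le
    _ ≤ ‖ci‖ * Bci + ‖x₀‖ * ‖c₀‖ * Bs₀ + ‖x₁‖ * ‖c₁‖ * Bs₁ := by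
        rw [norm_mul, norm_mul, norm_mul, norm_mul, norm_mul]
        gcongr

/-- The same with the roles of the kink lines read off for component `0` (`Sᵢ = S₀`, `cᵢ = c₀`) — a restatement for convenience. [folklore] -/
theorem norm_component_zero_le {kc ks : ℝ → ℝ} (hkc : Continuous kc) (hks : Continuous ks) {S₀ S₁ : ℝ → ℂ}
    (hS₀ : Continuous S₀) (hS₁ : Continuous S₁) (c₀ c₁ x₀ x₁ : ℂ) {a b Bc₀ Bs₀ Bs₁ : ℝ}
    (hBc₀ : ‖∫ s in a..b, (kc s : ℂ) * S₀ s‖ ≤ Bc₀) (hBs₀ : ‖∫ s in a..b, (ks s : ℂ) * S₀ s‖ ≤ Bs₀)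
    (hBs₁ : ‖∫ s in a..b, (ks s : ℂ) * S₁ s‖ ≤ Bs₁) :
    ‖∫ s in a..b, ((kc s : ℂ) * (c₀ * S₀ s) + (ks s : ℂ) * (x₀ * (c₀ * S₀ s) + x₁ * (c₁ * S₁ s)))‖ ≤
      ‖c₀‖ * Bc₀ + ‖x₀‖ * ‖c₀‖ * Bs₀ + ‖x₁‖ * ‖c₁‖ * Bs₁ :=
  norm_component_le hkc hks hS₀ hS₁ hS₀ c₀ c₀ c₁ x₀ x₁ hBc₀ hBs₀ hBs₁

/-- Component `1` (`Sᵢ = S₁`, `cᵢ = c₁`). [folklore] -/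
theorem norm_component_one_le {kc ks : ℝ → ℝ} (hkc : Continuous kc) (hks : Continuous ks) {S₀ S₁ : ℝ → ℂ}
    (hS₀ : Continuous S₀) (hS₁ : Continuous S₁) (c₀ c₁ x₀ x₁ : ℂ) {a b Bc₁ Bs₀ Bs₁ : ℝ}
    (hBc₁ : ‖∫ s in a..b, (kc s : ℂ) * S₁ s‖ ≤ Bc₁) (hBs₀ : ‖∫ s in a..b, (ks s : ℂ) * S₀ s‖ ≤ Bs₀)
    (hBs₁ : ‖∫ s in a..b, (ks s : ℂ) * S₁ s‖ ≤ Bs₁) :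
    ‖∫ s in a..b, ((kc s : ℂ) * (c₁ * S₁ s) + (ks s : ℂ) * (x₀ * (c₀ * S₀ s) + x₁ * (c₁ * S₁ s)))‖ ≤
      ‖c₁‖ * Bc₁ + ‖x₀‖ * ‖c₀‖ * Bs₀ + ‖x₁‖ * ‖c₁‖ * Bs₁ :=
  norm_component_le hkc hks hS₀ hS₁ hS₁ c₁ c₀ c₁ x₀ x₁ hBc₁ hBs₀ hBs₁

end Summit.AnomalousDissipation.AnomalousDissipation.Theorems.SawtoothPulseCascade.K2PhaseBudget

end
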